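import Literature.MathematicalPhysics.QuantumFieldTheory.Balaban1983to89.B1Eq324BenfattoClassSectEMember
import Literature.MathematicalPhysics.QuantumFieldTheory.Balaban1983to89.B6Cov2156TorusDelK
import HarnessLib

/-!
# `Balaban1983to89.B1Eq324BenfattoClassSectEMemberZeroBackground` — seat n08-b's Sect.-E one-stop `…ClassSectEMember.eq324_sectEPrecision_torus_on_unit`
# IS INHABITED AT THE PRINTED ZERO-BACKGROUND MEMBER: its displayed Sect.-E binders (`P`, `𝒥`, `a`, the local elimination matrix `E`, the lower bound `γ₀`)
# are discharged, at `U = 1`, by the `pub-balaban` torus lineage of [Balaban1984PropagatorsII] (2.152)–(2.157) — so [Balaban1982Higgs1] (3.24) holds for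
# the Gaussian field of `C*Δ_kC` on every cubic torus at every level THROUGH THE SECT.-E DOOR, with the same kernel as this seat's `…ClassTorusGaugeFluctuation`

statement-level companion of a published source with citation tags; every declaration here is a theorem; nothing here is
a claim about the Yang–Mills mass gap

WHY THIS MODULE (cell `pub-ymgap`, seat `dag-n08-d` gen 16, OFFER-77 / CLAIM-78; node N08 [Balaban1985UV3]; the [BenfattoEtAl1978] source chain behind the
(α)-row `h324`).  Seat n08-b's `…ClassSectEMember` (p645440) states (3.24) for the Gaussian field of the Sect.-E fluctuation precision
`T := Eᵀ(P − a·1 − 𝒥)E` of [Balaban1985BackgroundPropagators] (3.156)–(3.158) on a labelled torus block with the Sect.-E inputs DISPLAYED (N06's content at a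
general background `U`): `P`, `𝒥` symmetric with `e^{−δρ}` decay, `|a| ≤ a₀`, `E` local (range `r`, column mass `m_C`), `γ₀`-coercivity of `T`.  Seat n08-w4's
`…RowClassSocketEndSectE` (CLAIM-4) consumes that one-stop Summits-side.  THIS FILE certifies that the displayed binder list is JOINTLY SATISFIABLE BY A PRINTED
MEMBER — the zero-background one: on the unit torus `T^{(k)}` with `U = 1`, [Balaban1984PropagatorsI] (1.65)'s `Δ_k` (`B6Cov2156TorusDelK.reDelK`, the
genuine operator in the bond basis; `Im Δ_k = 0`) plays `P` with `a := 0`, `𝒥 := 0` (at `U = 1` there is no `J`-term and the constant is absorbed: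
`P − 0·1 − 0 = Re Δ_k`), the explicit elimination matrix `C = elimT L M` of [Balaban1984PropagatorsII] p. 250 plays `E` (range `L − 1`, column mass `2`:
`B6Cov2156Torus.elimT_range` / `elimT_col`), the periodic sup-distance `ρ_M` of the base points plays `ρ` (`IsPseudoDist`: the `zdPer` frame of
`B6BondEliminationTorus`), `kernelDecay_reDelK` gives the decay (constants from `d` only) and `ineq_2157_reDelK_sharp` the lower bound
`γ₀ = γ′₀ = (1/12d²)L^{−d−1}` — so the one-stop FIRES, with NO displayed input left, at every cubic torus `(ℤ/N)^d` (`L ∣ N`, `B′ ≠ ∅`) and every level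
`n = L^k`; the resulting kernel `K` is the one of this seat's `…ClassTorusGaugeFluctuation.eq324_torusGaugeFluctuation_on_unit` (p645592; the road's END
composed directly) — the two routes to (3.24) at the zero-background gauge-field member AGREE.

WHAT IS PROVED (theorems only; no definition, no named fact, no `sorry`; axioms standard).
* §1 glue (private): `sum_mul_mulVec_eq_sum_sum`, `circAbs_le_pdist`, `abs_valMinAbs_le_pdist`, `siteLab_injective`, `isPseudoDist_bondDist` (`ρ_M` of the
  base points is a pseudo-distance on the bond variables).
* §2 ★★★ `eq324_torusGauge_via_sectE_on_unit` — for `d ≥ 2`, `L ≥ 1` and the (3.24) letters (`t`, `D`, `ϰ > 0`, `p₀ > 2/3`, `σ > 0`, `c ≥ 0`,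
  `0 < κ < σ(t+1)`): `∃ b₁ ∀ b₀ > b₁ ∃ C ≥ 0 ∀ η ∈ (0,1] ∀ N` (`L ∣ N`, `freeT ≠ ∅`) `∀ n ≥ 1 ∃ Λ ⊂ ℤ^{d+d+1}, e : B′ ≃ Λ`: the class field `μ_K`
  (`K` = zero-extended `(reindex e e (Cᵀ(Re Δ_k − 0·1 − 0)C))⁻¹`) presents `𝒩(0, (Cᵀ(Re Δ_k − 0·1 − 0)C)⁻¹)`, the box pull-back a.e., and the (3.24) pair
  for every `(s, J ⊆ I, J ⊆ Λ, 𝔄)` with `I ≠ ∅`, `sup|𝔄| ≤ c·η^σ` — seat n08-b's `eq324_sectEPrecision_torus_on_unit` conclusion VERBATIM at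
  `(υ, ρ, β, site, lab, ι, P, 𝒥, a, E) := (bonds of the box of representatives, ρ_M, freeT L M, k₋ mod N, direction, inclusion, Re Δ_k, 0, 0, elimT)`,
  class scalars `(γ₀, K_P, K_𝒥, a₀, δ, r, m_C) := (γ′₀, c₀, 0, 0, δ₀, L − 1, 2)` from `(d, L)` only.
* §3 ★★ `eq324_torusGauge_via_sectE_on_unit'` — the same with the member rewritten as `Cᵀ·(Re Δ_k)·C` (`P − 0·1 − 0 = P`): literally the kernel of
  p645592's `eq324_torusGaugeFluctuation_on_unit` (binder order of the Sect.-E door: the window `Λ, e` after `η`).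
* Non-vacuity `example` at `d = 3`, `L = 2`, the d = 3 lane's letters.

HONEST SCOPE / NOT HERE.  An A6-type SATISFIABILITY certificate for seat n08-b's displayed Sect.-E binder list, by name, at the PRINTED zero-background member
of the `pub-balaban` lineage (`B6Cov2156TorusDelK` and its imports); no estimate re-proved; nothing of p645440 or p645592 restated (both consumed by name;
the three private glue lemmas of p645592 are re-derived privately here).  Zero background only: at a GENERAL background the binders `P = (QG₁(U)Q*)⁻¹`,
`𝒥(U)`, `a`, `γ₀` are N06 [Balaban1985BackgroundPropagators] Sect. E's content (G-B9-09) — NOT discharged here, NOT claimed; the IDENT's class-II letters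
(`𝒱`, `χ` of [Balaban1985UV3]) stay the road's generic `hamiltonian` / `cutoffBoltzmann`; the window `b₁ < b₀` is displayed.  IDENT NOT commissioned /
NOT claimed; nothing of [Balaban1985UV3] / [Balaban1985UV2] / [BenfattoEtAl1978] asserted or discharged; `PrintedUV3V` NOT proved; N08 NOT discharged by
this file; count-neutral; nothing about d = 4 specifically, the continuum, OS axioms, a mass gap or the Clay problem.
-/

noncomputable section

open MeasureTheory Finset Matrix
open scoped BigOperators

namespace Literature.MathematicalPhysics.QuantumFieldTheory.Balaban1983to89.B1Eq324BenfattoClassSectEMemberZeroBackground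

open Literature.MathematicalPhysics.QuantumFieldTheory
open Literature.MathematicalPhysics.QuantumFieldTheory.Balaban1983to89.B1Eq324BenfattoLemma
open Literature.MathematicalPhysics.QuantumFieldTheory.Balaban1983to89.B4Sect5Torus (IsPseudoDist tdist ccoord ccoord_cast)
open Literature.MathematicalPhysics.QuantumFieldTheory.Balaban1983to89.B4TorusKernel.MultiPeriod (circAbs circAbs_nonneg)
open Literature.MathematicalPhysics.QuantumFieldTheory.Balaban1983to89.B6Lemma24Torus (pbox mem_pbox)
open Literature.MathematicalPhysics.QuantumFieldTheory.Balaban1983to89.B6BondEliminationTorus (res res_val pdist zdPer circAbs_res)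
open Literature.MathematicalPhysics.QuantumFieldTheory.Balaban1983to89.B6Cov2156Torus
  (one_le_M freeT elimT elimT_range elimT_col)
open Literature.MathematicalPhysics.QuantumFieldTheory.Balaban1983to89.B6Cov2156TorusDelK
  (reDelK reDelK_isSymm kernelDecay_reDelK ineq_2157_reDelK_sharp gamma2153one gamma2153one_pos)
open Literature.MathematicalPhysics.QuantumFieldTheory.Balaban1983to89.B1Eq324BenfattoClassSectEMember
  (eq324_sectEPrecision_torus_on_unit)

variable {d L : ℕ}

/-! ## §1  Glue (private) -/

/-- the class form in two currencies. [folklore] -/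
private theorem sum_mul_mulVec_eq_sum_sum {ι : Type*} [Fintype ι] (A : Matrix ι ι ℝ) (v : ι → ℝ) :
    ∑ e, v e * A.mulVec v e = ∑ e, ∑ e', A e e' * v e * v e' := by
  simp only [Matrix.mulVec, dotProduct, Finset.mul_sum]
  exact Finset.sum_congr rfl fun e _ => Finset.sum_congr rfl fun e' _ => by ring

/-- each coordinate circular distance is at most the periodic sup-distance `ρ_M`. [folklore] -/
private theorem circAbs_le_pdist (M : Fin d → ℕ) [∀ μ, NeZero (M μ)] (x y : Fin d → ℤ) (i : Fin d) :
    ((circAbs (M i) (x i - y i) : ℤ) : ℝ) ≤ pdist M (one_le_M M) x y := by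
  have h1 : ccoord M (res M (one_le_M M) x) (res M (one_le_M M) y) i ≤
      Finset.univ.sup (ccoord M (res M (one_le_M M) x) (res M (one_le_M M) y)) :=
    Finset.le_sup (f := ccoord M (res M (one_le_M M) x) (res M (one_le_M M) y)) (Finset.mem_univ i)
  have h2 : ((ccoord M (res M (one_le_M M) x) (res M (one_le_M M) y) i : ℕ) : ℤ) = circAbs (M i) (x i - y i) := by
    rw [ccoord_cast (one_le_M M), circAbs_res]
  unfold pdist tdist
  calc ((circAbs (M i) (x i - y i) : ℤ) : ℝ)
      = (((ccoord M (res M (one_le_M M) x) (res M (one_le_M M) y) i : ℕ) : ℤ) : ℝ) := by rw [h2]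
    _ = ((ccoord M (res M (one_le_M M) x) (res M (one_le_M M) y) i : ℕ) : ℝ) := by norm_cast
    _ ≤ _ := by exact_mod_cast h1

/-- `|(x̄_i − ȳ_i).valMinAbs| = circAbs N (x_i − y_i) ≤ ρ_N(x, y)`. [folklore] -/
private theorem abs_valMinAbs_le_pdist (N : ℕ) [NeZero N] (x y : Fin d → ℤ) (i : Fin d) :
    (|((((x i : ℤ) : ZMod N) - ((y i : ℤ) : ZMod N)).valMinAbs : ℤ)| : ℝ) ≤
      pdist (fun _ : Fin d => N) (one_le_M fun _ : Fin d => N) x y := by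
  have hz : (((x i : ℤ) : ZMod N) - ((y i : ℤ) : ZMod N)) = ((x i - y i : ℤ) : ZMod N) := by push_cast; rfl
  have hnat : (((((x i : ℤ) : ZMod N) - ((y i : ℤ) : ZMod N)).valMinAbs.natAbs : ℕ) : ℤ) = circAbs N (x i - y i) := by
    rw [hz, ZMod.valMinAbs_natAbs_eq_min]
    have hv : ((((x i - y i : ℤ) : ZMod N)).val : ℤ) = (x i - y i) % (N : ℤ) := ZMod.val_intCast (x i - y i)
    have hle : (((x i - y i : ℤ) : ZMod N)).val ≤ N := (ZMod.val_lt _).le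
    rw [Nat.cast_min, Nat.cast_sub hle, hv]
    rfl
  have habs : |((((x i : ℤ) : ZMod N) - ((y i : ℤ) : ZMod N)).valMinAbs : ℤ)| = circAbs N (x i - y i) := by
    rw [Int.abs_eq_natAbs, hnat]
  rw [← Int.cast_abs, habs]
  exact circAbs_le_pdist (fun _ : Fin d => N) x y i

/-- a bond of the box of representatives is determined by (residue of its base point, direction). [folklore] -/
private theorem siteLab_injective (N : ℕ) [NeZero N] (S : Finset (B4.Idx (pbox (fun _ : Fin d => N)) d)) :
    Function.Injective fun k : ↥S =>
      ((fun i : Fin d => ((((k : B4.Idx (pbox (fun _ : Fin d => N)) d).1 : Fin d → ℤ) i : ℤ) : ZMod N)),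
        (k : B4.Idx (pbox (fun _ : Fin d => N)) d).2) := by
  intro k k' h
  simp only [Prod.mk.injEq] at h
  obtain ⟨hs, hl⟩ := h
  have hx : (((k : B4.Idx (pbox (fun _ : Fin d => N)) d).1 : Fin d → ℤ)) =
      (((k' : B4.Idx (pbox (fun _ : Fin d => N)) d).1 : Fin d → ℤ)) := by
    funext i
    have hi := congrFun hs i
    have hk := (mem_pbox.mp (k : B4.Idx (pbox (fun _ : Fin d => N)) d).1.2) i
    have hk' := (mem_pbox.mp (k' : B4.Idx (pbox (fun _ : Fin d => N)) d).1.2) i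
    have hmod : (((k : B4.Idx (pbox (fun _ : Fin d => N)) d).1 : Fin d → ℤ) i) % (N : ℤ) =
        (((k' : B4.Idx (pbox (fun _ : Fin d => N)) d).1 : Fin d → ℤ) i) % (N : ℤ) :=
      (ZMod.intCast_eq_intCast_iff' _ _ _).mp hi
    rwa [Int.emod_eq_of_lt hk.1 hk.2, Int.emod_eq_of_lt hk'.1 hk'.2] at hmod
  exact Subtype.ext (Prod.ext (Subtype.ext hx) hl)

/-- `ρ_M` of the base points is a pseudo-distance on the bond variables of the box (the `zdPer` frame's axioms). [folklore] -/
private theorem isPseudoDist_bondDist (M : Fin d → ℕ) [∀ μ, NeZero (M μ)] :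
    IsPseudoDist (fun u v : B4.Idx (pbox M) d => pdist M (one_le_M M) (u.1 : Fin d → ℤ) (v.1 : Fin d → ℤ)) where
  symm _ _ := (zdPer d M (one_le_M M)).ρ_comm _ _
  zero _ := (zdPer d M (one_le_M M)).ρ_self _
  triangle _ _ _ := (zdPer d M (one_le_M M)).ρ_triangle _ _ _

/-! ## §2  The Sect.-E one-stop FIRES at the zero-background member of the torus lineage -/

/-- ★★★ **SEAT n08-b's SECT.-E ONE-STOP INHABITED AT `U = 1`.**  For `d ≥ 2`, `L ≥ 1`, every order `t`, degree `D`, tree rate `ϰ > 0` and rate letters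
`p₀ > 2/3`, `σ > 0`, `c ≥ 0`, `0 < κ < σ(t+1)` there is a threshold window `b₁` (from `(d, L)` and the letters) such that for every `b₀ > b₁` there is
`C ≥ 0` with: for EVERY `η ∈ (0,1]`, EVERY cubic torus `(ℤ/N)^d` with `L ∣ N` and non-empty remaining variables `B′ = freeT`, EVERY level `n ≥ 1`, there are
a window `Λ ⊂ ℤ^{d+d+1}` and a bijection `e : B′ ≃ Λ` such that, with `T := Cᵀ(Re Δ_k − 0·1 − 0)C` (`C = elimT L M`) and `K` the zero-extension of
`(reindex e e T)⁻¹`: `(μ_K).map (z ↦ z ∘ e) = 𝒩(0, T⁻¹)`, the uniform-threshold boxes pull back to `smallFieldSet Λ p` a.e., and for every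
`(s, J ⊆ I, J ⊆ Λ, 𝔄)` with `I ≠ ∅`, `sup|𝔄| ≤ c·η^σ`: `0 < ∫Π_Δχ̂_{I,p(η)}e^{H_J}dμ_K ∧ |log ∫Π_Δχ̂_{I,p(η)}e^{H_J}dμ_K − Σ_{k≤t}𝓔^T(H_J;k)/k!| ≤ C·η^κ·|I|`
— `…ClassSectEMember.eq324_sectEPrecision_torus_on_unit` with EVERY displayed binder supplied: `ρ := ρ_M` on bonds (`isPseudoDist_bondDist`),
`site := k₋ mod N`, `lab :=` direction (`siteLab_injective`, `abs_valMinAbs_le_pdist`), `P := Re Δ_k` (`reDelK_isSymm`, `kernelDecay_reDelK`), `𝒥 := 0`,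
`a := 0`, `E := elimT` (`elimT_range`: `ρ ≤ L − 1`; `elimT_col`: column mass `2`), `γ₀ := γ′₀ = (1/12d²)L^{−d−1}` (`ineq_2157_reDelK_sharp`).
[cite: Balaban1985BackgroundPropagators, (3.156)–(3.158) p.428 (the door's letters); Balaban1984PropagatorsII, (2.152)–(2.157) pp.249–250 (the member at
U = 1); Balaban1984PropagatorsI, (1.65) p.29; Balaban1982Higgs1, (3.24) p.616; BenfattoEtAl1978, Lemma (4.5)–(4.7) p.152 (class form; ours)] -/
theorem eq324_torusGauge_via_sectE_on_unit (hd : 2 ≤ d) (hL : 1 ≤ L) (t D : ℕ) {ϰ : ℝ} (hϰ : 0 < ϰ) {p₀ σ c κ : ℝ}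
    (hp₀ : 2 / 3 < p₀) (hσ : 0 < σ) (hc : 0 ≤ c) (hκ : 0 < κ) (hκσ : κ < σ * (t + 1)) :
    ∃ b₁ : ℝ, ∀ b₀ : ℝ, b₁ < b₀ → ∃ C : ℝ, 0 ≤ C ∧ ∀ η : ℝ, 0 < η → η ≤ 1 →
      ∀ (N : ℕ) [NeZero N], L ∣ N → (freeT L (fun _ : Fin d => N)).Nonempty → ∀ (n : ℕ) (hn : 1 ≤ n),
        ∃ (Λ : Finset (B1Eq324BenfattoLemma.Site (d + d + 1))) (e : ↥(freeT L (fun _ : Fin d => N)) ≃ ↥Λ),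
          ((gaussianFieldOfKernel fun x y => if h : x ∈ Λ ∧ y ∈ Λ then
              ((Matrix.reindex e e ((elimT L (fun _ : Fin d => N))ᵀ *
                (reDelK n hn (fun _ : Fin d => N) - (0 : ℝ) • (1 : Matrix (B4.Idx (pbox (fun _ : Fin d => N)) d)
                  (B4.Idx (pbox (fun _ : Fin d => N)) d) ℝ) - 0) * elimT L (fun _ : Fin d => N)))⁻¹ : Matrix ↥Λ ↥Λ ℝ) ⟨x, h.1⟩ ⟨y, h.2⟩ else 0).map
              (fun (z : B1Eq324BenfattoLemma.Site (d + d + 1) → ℝ) (b : ↥(freeT L (fun _ : Fin d => N))) =>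
                z ((e b : ↥Λ) : B1Eq324BenfattoLemma.Site (d + d + 1))) =
            gaussianFieldOfKernel fun b b' =>
              (((elimT L (fun _ : Fin d => N))ᵀ *
                (reDelK n hn (fun _ : Fin d => N) - (0 : ℝ) • (1 : Matrix (B4.Idx (pbox (fun _ : Fin d => N)) d)
                  (B4.Idx (pbox (fun _ : Fin d => N)) d) ℝ) - 0) * elimT L (fun _ : Fin d => N))⁻¹ :
                Matrix ↥(freeT L (fun _ : Fin d => N)) ↥(freeT L (fun _ : Fin d => N)) ℝ) b b') ∧
          (∀ p : ℝ, 0 ≤ p →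
            ((fun (z : B1Eq324BenfattoLemma.Site (d + d + 1) → ℝ) (b : ↥(freeT L (fun _ : Fin d => N))) =>
                z ((e b : ↥Λ) : B1Eq324BenfattoLemma.Site (d + d + 1))) ⁻¹' {ω : ↥(freeT L (fun _ : Fin d => N)) → ℝ | ∀ b, |ω b| ≤ p}) =ᵐ[
              gaussianFieldOfKernel fun x y => if h : x ∈ Λ ∧ y ∈ Λ then
                ((Matrix.reindex e e ((elimT L (fun _ : Fin d => N))ᵀ *
                  (reDelK n hn (fun _ : Fin d => N) - (0 : ℝ) • (1 : Matrix (B4.Idx (pbox (fun _ : Fin d => N)) d)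
                    (B4.Idx (pbox (fun _ : Fin d => N)) d) ℝ) - 0) * elimT L (fun _ : Fin d => N)))⁻¹ : Matrix ↥Λ ↥Λ ℝ) ⟨x, h.1⟩ ⟨y, h.2⟩ else 0]
              smallFieldSet Λ p) ∧
          ∀ (s : ℕ) (I J : Finset (B1Eq324BenfattoLemma.Site (d + d + 1))) (𝔞 : Coef (d + d + 1)), I.Nonempty → J ⊆ I → J ⊆ Λ →
            coefSup s D 𝔞 J ≤ c * η ^ σ →
            0 < ∫ z, cutoffBoltzmann (hamiltonian s D ϰ 𝔞 J) I (B10.pFun b₀ p₀ η) z ∂(gaussianFieldOfKernel fun x y => if h : x ∈ Λ ∧ y ∈ Λ then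
                ((Matrix.reindex e e ((elimT L (fun _ : Fin d => N))ᵀ *
                  (reDelK n hn (fun _ : Fin d => N) - (0 : ℝ) • (1 : Matrix (B4.Idx (pbox (fun _ : Fin d => N)) d)
                    (B4.Idx (pbox (fun _ : Fin d => N)) d) ℝ) - 0) * elimT L (fun _ : Fin d => N)))⁻¹ : Matrix ↥Λ ↥Λ ℝ) ⟨x, h.1⟩ ⟨y, h.2⟩ else 0) ∧
              |Real.log (∫ z, cutoffBoltzmann (hamiltonian s D ϰ 𝔞 J) I (B10.pFun b₀ p₀ η) z ∂(gaussianFieldOfKernel fun x y =>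
                  if h : x ∈ Λ ∧ y ∈ Λ then
                    ((Matrix.reindex e e ((elimT L (fun _ : Fin d => N))ᵀ *
                      (reDelK n hn (fun _ : Fin d => N) - (0 : ℝ) • (1 : Matrix (B4.Idx (pbox (fun _ : Fin d => N)) d)
                        (B4.Idx (pbox (fun _ : Fin d => N)) d) ℝ) - 0) * elimT L (fun _ : Fin d => N)))⁻¹ : Matrix ↥Λ ↥Λ ℝ) ⟨x, h.1⟩ ⟨y, h.2⟩
                  else 0)) -
                cumulantSum (gaussianFieldOfKernel fun x y => if h : x ∈ Λ ∧ y ∈ Λ then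
                    ((Matrix.reindex e e ((elimT L (fun _ : Fin d => N))ᵀ *
                      (reDelK n hn (fun _ : Fin d => N) - (0 : ℝ) • (1 : Matrix (B4.Idx (pbox (fun _ : Fin d => N)) d)
                        (B4.Idx (pbox (fun _ : Fin d => N)) d) ℝ) - 0) * elimT L (fun _ : Fin d => N)))⁻¹ : Matrix ↥Λ ↥Λ ℝ) ⟨x, h.1⟩ ⟨y, h.2⟩
                  else 0)
                  (hamiltonian s D ϰ 𝔞 J) t| ≤ C * η ^ κ * I.card := by
  have hd1 : 1 ≤ d := le_trans (by norm_num) hd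
  have hd0 : 0 < d := hd1
  have hL0 : 0 < L := hL
  -- the decay of `Re Δ_k` (constants from `d` only) and the class scalars
  obtain ⟨c₀, δ₀, hc0, hδ, hK⟩ := kernelDecay_reDelK (d := d) hd1
  have hγ := gamma2153one_pos hd1 hL
  obtain ⟨b₁, hb₁⟩ := eq324_sectEPrecision_torus_on_unit (d := d) hd0 d (γ₀ := gamma2153one d L) (KP := c₀) (KJ := 0) (a₀ := 0)
    (δ := δ₀) (r := (L : ℝ) - 1) (mC := 2) hγ hc0.le le_rfl le_rfl hδ (by norm_num) t D hϰ hp₀ hσ hc hκ hκσ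
  refine ⟨b₁, fun b₀ hb₀ => ?_⟩
  obtain ⟨C, hC, hE⟩ := hb₁ b₀ hb₀
  refine ⟨C, hC, fun η hη hη1 N _ hLN hne n hn => ?_⟩
  haveI : Nonempty ↥(freeT L (fun _ : Fin d => N)) := by
    obtain ⟨k, hk⟩ := hne
    exact ⟨⟨k, hk⟩⟩
  -- the displayed binders at `U = 1`
  have hPs : ∀ u v : B4.Idx (pbox (fun _ : Fin d => N)) d,
      reDelK n hn (fun _ : Fin d => N) u v = reDelK n hn (fun _ : Fin d => N) v u :=
    fun u v => (reDelK_isSymm n hn (fun _ : Fin d => N)).apply v u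
  have hJs : ∀ u v : B4.Idx (pbox (fun _ : Fin d => N)) d,
      (0 : Matrix (B4.Idx (pbox (fun _ : Fin d => N)) d) (B4.Idx (pbox (fun _ : Fin d => N)) d) ℝ) u v =
        (0 : Matrix (B4.Idx (pbox (fun _ : Fin d => N)) d) (B4.Idx (pbox (fun _ : Fin d => N)) d) ℝ) v u := fun u v => rfl
  have hPdec : ∀ u v : B4.Idx (pbox (fun _ : Fin d => N)) d, |reDelK n hn (fun _ : Fin d => N) u v| ≤
      c₀ * Real.exp (-(δ₀ * pdist (fun _ : Fin d => N) (one_le_M fun _ : Fin d => N) (u.1 : Fin d → ℤ) (v.1 : Fin d → ℤ))) :=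
    fun u v => hK (fun _ : Fin d => N) n hn u v
  have hJdec : ∀ u v : B4.Idx (pbox (fun _ : Fin d => N)) d,
      |(0 : Matrix (B4.Idx (pbox (fun _ : Fin d => N)) d) (B4.Idx (pbox (fun _ : Fin d => N)) d) ℝ) u v| ≤
        0 * Real.exp (-(δ₀ * pdist (fun _ : Fin d => N) (one_le_M fun _ : Fin d => N) (u.1 : Fin d → ℤ) (v.1 : Fin d → ℤ))) :=
    fun u v => by simp
  have ha : |(0 : ℝ)| ≤ 0 := by simp
  have hCr : ∀ (u : B4.Idx (pbox (fun _ : Fin d => N)) d) (b : ↥(freeT L (fun _ : Fin d => N))),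
      elimT L (fun _ : Fin d => N) u b ≠ 0 →
        pdist (fun _ : Fin d => N) (one_le_M fun _ : Fin d => N) (u.1 : Fin d → ℤ)
          (((b : B4.Idx (pbox (fun _ : Fin d => N)) d)).1 : Fin d → ℤ) ≤ (L : ℝ) - 1 :=
    fun u b h => elimT_range hL0 u b h
  have hC1 : ∀ b : ↥(freeT L (fun _ : Fin d => N)), ∑ u, |elimT L (fun _ : Fin d => N) u b| ≤ 2 :=
    fun b => elimT_col hL0 (fun _ => hLN) b
  have hco : ∀ v : ↥(freeT L (fun _ : Fin d => N)) → ℝ, gamma2153one d L * ∑ b, v b ^ 2 ≤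
      ∑ b, ∑ b', (((elimT L (fun _ : Fin d => N))ᵀ *
        (reDelK n hn (fun _ : Fin d => N) - (0 : ℝ) • (1 : Matrix (B4.Idx (pbox (fun _ : Fin d => N)) d)
          (B4.Idx (pbox (fun _ : Fin d => N)) d) ℝ) - 0) * elimT L (fun _ : Fin d => N) :
          Matrix ↥(freeT L (fun _ : Fin d => N)) ↥(freeT L (fun _ : Fin d => N)) ℝ)) b b' * v b * v b' := by
    intro v
    have h := ineq_2157_reDelK_sharp (M := fun _ : Fin d => N) hd hL (fun _ => hLN) n hn v
    rw [zero_smul, sub_zero, sub_zero, ← sum_mul_mulVec_eq_sum_sum]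
    exact h.2.trans h.1
  exact hE η hη hη1 (N := N)
    (fun u v : B4.Idx (pbox (fun _ : Fin d => N)) d =>
      pdist (fun _ : Fin d => N) (one_le_M fun _ : Fin d => N) (u.1 : Fin d → ℤ) (v.1 : Fin d → ℤ))
    (isPseudoDist_bondDist fun _ : Fin d => N)
    (fun k : ↥(freeT L (fun _ : Fin d => N)) =>
      (fun i : Fin d => ((((k : B4.Idx (pbox (fun _ : Fin d => N)) d).1 : Fin d → ℤ) i : ℤ) : ZMod N)))
    (fun k : ↥(freeT L (fun _ : Fin d => N)) => (k : B4.Idx (pbox (fun _ : Fin d => N)) d).2)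
    (siteLab_injective N (freeT L (fun _ : Fin d => N)))
    (fun k : ↥(freeT L (fun _ : Fin d => N)) => (k : B4.Idx (pbox (fun _ : Fin d => N)) d))
    (fun k k' i => abs_valMinAbs_le_pdist N _ _ i)
    hPs hJs hPdec hJdec ha hCr hC1 hco

/-! ## §3  The same with the member rewritten as `Cᵀ·(Re Δ_k)·C` — literally the kernel of p645592's `eq324_torusGaugeFluctuation_on_unit` -/

/-- ★★ **THE TWO ROUTES AGREE**: §2 with `Re Δ_k − 0·1 − 0` rewritten to `Re Δ_k`, i.e. (3.24) through seat n08-b's Sect.-E door for the Gaussian field of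
`K` = zero-extended `(reindex e e (Cᵀ·(Re Δ_k)·C))⁻¹` — the kernel of this seat's `…ClassTorusGaugeFluctuation.eq324_torusGaugeFluctuation_on_unit` (there the
window `Λ, e` is chosen before `η`; here, in the door's binder order, after).
[cite: Balaban1985BackgroundPropagators, (3.156)–(3.158) p.428; Balaban1984PropagatorsII, (2.155)–(2.157) p.250; Balaban1982Higgs1, (3.24) p.616;
BenfattoEtAl1978, Lemma (4.5)–(4.7) p.152 (class form; ours)] -/
theorem eq324_torusGauge_via_sectE_on_unit' (hd : 2 ≤ d) (hL : 1 ≤ L) (t D : ℕ) {ϰ : ℝ} (hϰ : 0 < ϰ) {p₀ σ c κ : ℝ}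
    (hp₀ : 2 / 3 < p₀) (hσ : 0 < σ) (hc : 0 ≤ c) (hκ : 0 < κ) (hκσ : κ < σ * (t + 1)) :
    ∃ b₁ : ℝ, ∀ b₀ : ℝ, b₁ < b₀ → ∃ C : ℝ, 0 ≤ C ∧ ∀ η : ℝ, 0 < η → η ≤ 1 →
      ∀ (N : ℕ) [NeZero N], L ∣ N → (freeT L (fun _ : Fin d => N)).Nonempty → ∀ (n : ℕ) (hn : 1 ≤ n),
        ∃ (Λ : Finset (B1Eq324BenfattoLemma.Site (d + d + 1))) (e : ↥(freeT L (fun _ : Fin d => N)) ≃ ↥Λ),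
          ((gaussianFieldOfKernel fun x y => if h : x ∈ Λ ∧ y ∈ Λ then
              ((Matrix.reindex e e ((elimT L (fun _ : Fin d => N))ᵀ * reDelK n hn (fun _ : Fin d => N) * elimT L (fun _ : Fin d => N)))⁻¹ : Matrix ↥Λ ↥Λ ℝ) ⟨x, h.1⟩ ⟨y, h.2⟩ else 0).map
              (fun (z : B1Eq324BenfattoLemma.Site (d + d + 1) → ℝ) (b : ↥(freeT L (fun _ : Fin d => N))) =>
                z ((e b : ↥Λ) : B1Eq324BenfattoLemma.Site (d + d + 1))) =
            gaussianFieldOfKernel fun b b' =>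
              (((elimT L (fun _ : Fin d => N))ᵀ * reDelK n hn (fun _ : Fin d => N) * elimT L (fun _ : Fin d => N))⁻¹ :
                Matrix ↥(freeT L (fun _ : Fin d => N)) ↥(freeT L (fun _ : Fin d => N)) ℝ) b b') ∧
          (∀ p : ℝ, 0 ≤ p →
            ((fun (z : B1Eq324BenfattoLemma.Site (d + d + 1) → ℝ) (b : ↥(freeT L (fun _ : Fin d => N))) =>
                z ((e b : ↥Λ) : B1Eq324BenfattoLemma.Site (d + d + 1))) ⁻¹' {ω : ↥(freeT L (fun _ : Fin d => N)) → ℝ | ∀ b, |ω b| ≤ p}) =ᵐ[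
              gaussianFieldOfKernel fun x y => if h : x ∈ Λ ∧ y ∈ Λ then
                ((Matrix.reindex e e ((elimT L (fun _ : Fin d => N))ᵀ * reDelK n hn (fun _ : Fin d => N) * elimT L (fun _ : Fin d => N)))⁻¹ : Matrix ↥Λ ↥Λ ℝ) ⟨x, h.1⟩ ⟨y, h.2⟩ else 0]
              smallFieldSet Λ p) ∧
          ∀ (s : ℕ) (I J : Finset (B1Eq324BenfattoLemma.Site (d + d + 1))) (𝔞 : Coef (d + d + 1)), I.Nonempty → J ⊆ I → J ⊆ Λ →
            coefSup s D 𝔞 J ≤ c * η ^ σ →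
            0 < ∫ z, cutoffBoltzmann (hamiltonian s D ϰ 𝔞 J) I (B10.pFun b₀ p₀ η) z ∂(gaussianFieldOfKernel fun x y => if h : x ∈ Λ ∧ y ∈ Λ then
                ((Matrix.reindex e e ((elimT L (fun _ : Fin d => N))ᵀ * reDelK n hn (fun _ : Fin d => N) * elimT L (fun _ : Fin d => N)))⁻¹ : Matrix ↥Λ ↥Λ ℝ) ⟨x, h.1⟩ ⟨y, h.2⟩ else 0) ∧
              |Real.log (∫ z, cutoffBoltzmann (hamiltonian s D ϰ 𝔞 J) I (B10.pFun b₀ p₀ η) z ∂(gaussianFieldOfKernel fun x y =>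
                  if h : x ∈ Λ ∧ y ∈ Λ then
                    ((Matrix.reindex e e ((elimT L (fun _ : Fin d => N))ᵀ * reDelK n hn (fun _ : Fin d => N) * elimT L (fun _ : Fin d => N)))⁻¹ : Matrix ↥Λ ↥Λ ℝ) ⟨x, h.1⟩ ⟨y, h.2⟩
                  else 0)) -
                cumulantSum (gaussianFieldOfKernel fun x y => if h : x ∈ Λ ∧ y ∈ Λ then
                    ((Matrix.reindex e e ((elimT L (fun _ : Fin d => N))ᵀ * reDelK n hn (fun _ : Fin d => N) * elimT L (fun _ : Fin d => N)))⁻¹ : Matrix ↥Λ ↥Λ ℝ) ⟨x, h.1⟩ ⟨y, h.2⟩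
                  else 0)
                  (hamiltonian s D ϰ 𝔞 J) t| ≤ C * η ^ κ * I.card := by
  obtain ⟨b₁, hb₁⟩ := eq324_torusGauge_via_sectE_on_unit (d := d) (L := L) hd hL t D hϰ hp₀ hσ hc hκ hκσ
  refine ⟨b₁, fun b₀ hb₀ => ?_⟩
  obtain ⟨C, hC, hE⟩ := hb₁ b₀ hb₀
  refine ⟨C, hC, fun η hη hη1 N _ hLN hne n hn => ?_⟩
  have h := hE η hη hη1 N hLN hne n hn
  simp only [zero_smul, sub_zero] at h
  exact h

/-! ## Non-vacuity at the physical dimension of [Balaban1985UV3] -/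

/-- non-vacuity at `d = 3` (window `ℤ^7`), `L = 2`, the d = 3 lane's letters `t = 6`, `D = 4`, `ϰ = 1`, `p₀ = 1`, `σ = ½`, `c = 1`, `κ = 13/4`: seat n08-b's
Sect.-E door fires at the zero-background member of every cubic torus `(ℤ/N)^3`, `2 ∣ N`, every level, every coupling. -/
example : ∃ b₁ : ℝ, ∀ b₀ : ℝ, b₁ < b₀ → ∃ C : ℝ, 0 ≤ C ∧ ∀ η : ℝ, 0 < η → η ≤ 1 →
      ∀ (N : ℕ) [NeZero N], 2 ∣ N → (freeT 2 (fun _ : Fin 3 => N)).Nonempty → ∀ (n : ℕ) (hn : 1 ≤ n),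
        ∃ (Λ : Finset (B1Eq324BenfattoLemma.Site (3 + 3 + 1))) (e : ↥(freeT 2 (fun _ : Fin 3 => N)) ≃ ↥Λ),
          ((gaussianFieldOfKernel fun x y => if h : x ∈ Λ ∧ y ∈ Λ then
              ((Matrix.reindex e e ((elimT 2 (fun _ : Fin 3 => N))ᵀ * reDelK n hn (fun _ : Fin 3 => N) * elimT 2 (fun _ : Fin 3 => N)))⁻¹ : Matrix ↥Λ ↥Λ ℝ) ⟨x, h.1⟩ ⟨y, h.2⟩ else 0).map
              (fun (z : B1Eq324BenfattoLemma.Site (3 + 3 + 1) → ℝ) (b : ↥(freeT 2 (fun _ : Fin 3 => N))) =>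
                z ((e b : ↥Λ) : B1Eq324BenfattoLemma.Site (3 + 3 + 1))) =
            gaussianFieldOfKernel fun b b' =>
              (((elimT 2 (fun _ : Fin 3 => N))ᵀ * reDelK n hn (fun _ : Fin 3 => N) * elimT 2 (fun _ : Fin 3 => N))⁻¹ :
                Matrix ↥(freeT 2 (fun _ : Fin 3 => N)) ↥(freeT 2 (fun _ : Fin 3 => N)) ℝ) b b') ∧
          (∀ p : ℝ, 0 ≤ p →
            ((fun (z : B1Eq324BenfattoLemma.Site (3 + 3 + 1) → ℝ) (b : ↥(freeT 2 (fun _ : Fin 3 => N))) =>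
                z ((e b : ↥Λ) : B1Eq324BenfattoLemma.Site (3 + 3 + 1))) ⁻¹' {ω : ↥(freeT 2 (fun _ : Fin 3 => N)) → ℝ | ∀ b, |ω b| ≤ p}) =ᵐ[
              gaussianFieldOfKernel fun x y => if h : x ∈ Λ ∧ y ∈ Λ then
                ((Matrix.reindex e e ((elimT 2 (fun _ : Fin 3 => N))ᵀ * reDelK n hn (fun _ : Fin 3 => N) * elimT 2 (fun _ : Fin 3 => N)))⁻¹ : Matrix ↥Λ ↥Λ ℝ) ⟨x, h.1⟩ ⟨y, h.2⟩ else 0]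
              smallFieldSet Λ p) ∧
          ∀ (s : ℕ) (I J : Finset (B1Eq324BenfattoLemma.Site (3 + 3 + 1))) (𝔞 : Coef (3 + 3 + 1)), I.Nonempty → J ⊆ I → J ⊆ Λ →
            coefSup s 4 𝔞 J ≤ 1 * η ^ (1 / 2 : ℝ) →
            0 < ∫ z, cutoffBoltzmann (hamiltonian s 4 1 𝔞 J) I (B10.pFun b₀ 1 η) z ∂(gaussianFieldOfKernel fun x y => if h : x ∈ Λ ∧ y ∈ Λ then
                ((Matrix.reindex e e ((elimT 2 (fun _ : Fin 3 => N))ᵀ * reDelK n hn (fun _ : Fin 3 => N) * elimT 2 (fun _ : Fin 3 => N)))⁻¹ : Matrix ↥Λ ↥Λ ℝ) ⟨x, h.1⟩ ⟨y, h.2⟩ else 0) ∧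
              |Real.log (∫ z, cutoffBoltzmann (hamiltonian s 4 1 𝔞 J) I (B10.pFun b₀ 1 η) z ∂(gaussianFieldOfKernel fun x y =>
                  if h : x ∈ Λ ∧ y ∈ Λ then
                    ((Matrix.reindex e e ((elimT 2 (fun _ : Fin 3 => N))ᵀ * reDelK n hn (fun _ : Fin 3 => N) * elimT 2 (fun _ : Fin 3 => N)))⁻¹ : Matrix ↥Λ ↥Λ ℝ) ⟨x, h.1⟩ ⟨y, h.2⟩
                  else 0)) -
                cumulantSum (gaussianFieldOfKernel fun x y => if h : x ∈ Λ ∧ y ∈ Λ then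
                    ((Matrix.reindex e e ((elimT 2 (fun _ : Fin 3 => N))ᵀ * reDelK n hn (fun _ : Fin 3 => N) * elimT 2 (fun _ : Fin 3 => N)))⁻¹ : Matrix ↥Λ ↥Λ ℝ) ⟨x, h.1⟩ ⟨y, h.2⟩
                  else 0)
                  (hamiltonian s 4 1 𝔞 J) 6| ≤ C * η ^ (13 / 4 : ℝ) * I.card :=
  eq324_torusGauge_via_sectE_on_unit' (d := 3) (L := 2) (by norm_num) (by norm_num) 6 4 one_pos
    (by norm_num) (by norm_num) zero_le_one (by norm_num) (by norm_num)

end Literature.MathematicalPhysics.QuantumFieldTheory.Balaban1983to89.B1Eq324BenfattoClassSectEMemberZeroBackground
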